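import Literature.Geometry.Lorentzian.DocStationarySpacetime
import Literature.Geometry.Lorentzian.CauchyDevelopmentRestrict
import Literature.Geometry.Lorentzian.ConnectionNaturality
import Literature.Geometry.Lorentzian.CurvatureNaturality
import Literature.Geometry.Lorentzian.KillingFieldOnNaturality
import Literature.Geometry.Lorentzian.Einstein
import Literature.Geometry.Manifold.OpenSubmanifoldMFDeriv
import HarnessLib

/-!
# Crux `HawkingExtensionIsKerr` (stmt-FinalStateConjecture-17840), line `SketchIdeator2` —
# collar zeroth law, step D: reading the collar on an open sub-carrier

Helper file of the line lead (c3), programme "collar zeroth law".  The local zeroth law (steps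
E1–E4, files `…LocalZerothLawStar/Codazzi/Trace`) is proved for a GLOBAL Killing field of a smooth
pseudo-Riemannian manifold; the collar field `K` of the crux is only Killing on an open set
`U ⊇ 𝓔⁺`.  Step D reads everything on an open sub-carrier `U' ⊆ U` of the presentation `𝓑`, where
`K|U'` IS a global Killing field of `g|U'`: the restricted metric is the pullback along the
inclusion (`restrict_eq_comap`), so (`isKillingField_restrict_of_isKillingFieldOn`) `K|U'` is
Killing, (`leviCivita_restrict_apply_of_mdifferentiableAt`) `∇^{g|U'} = ∇^g` on restricted fields,
(`ricci_restrict_apply`, `isRicciFlat_restrict_of_isRicciFlat`) the Ricci tensor restricts, and the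
values `g|U'_y = g_{y}` agree by `rfl`.  O'Neill 1983, Ch. 3, p. 57 and Prop. 3.59 (naturality
under the inclusion, an isometric open embedding).
-/

noncomputable section

set_option linter.dupNamespace false

namespace Summit.FinalStateConjecture.FinalStateConjecture.Theorems.HawkingExtensionIsKerr.SketchIdeator2

open Set Function Filter TopologicalSpace Bundle VectorField Literature.Geometry.Lorentzian
  Literature.Geometry.Manifold Literature.Geometry.Manifold.OpenSubmanifold
open scoped Manifold ContDiff Topology

section Restrict

variable (𝓑 : StationaryAFBlackHole.{0}) [𝓑.metric.HasLeviCivita] (U : Opens 𝓑.carrier)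
  [(𝓑.metric.restrict PseudoRiemannianMetric.contMDiff_restrict_holds U).HasLeviCivita]

omit [𝓑.metric.HasLeviCivita]
  [(𝓑.metric.restrict PseudoRiemannianMetric.contMDiff_restrict_holds U).HasLeviCivita] in
/-- Equal metrics have equal Levi-Civita connections, whatever the instances. [folklore] -/
theorem leviCivita_congr_metric''
    {g₁ g₂ : PseudoRiemannianMetric (𝓡 4) ∞ E4 (TangentSpace (𝓡 4) : U → Type _)} (h : g₁ = g₂)
    (i₁ : g₁.HasLeviCivita) (i₂ : g₂.HasLeviCivita) (X : Π x : U, TangentSpace (𝓡 4) x) (x : U) :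
    g₁.leviCivita X x = g₂.leviCivita X x := by
  subst h; rfl

omit [𝓑.metric.HasLeviCivita]
  [(𝓑.metric.restrict PseudoRiemannianMetric.contMDiff_restrict_holds U).HasLeviCivita] in
/-- Equal metrics have equal Ricci tensors, whatever the instances. [folklore] -/
theorem ricci_congr_metric''
    {g₁ g₂ : PseudoRiemannianMetric (𝓡 4) ∞ E4 (TangentSpace (𝓡 4) : U → Type _)} (h : g₁ = g₂)
    (i₁ : g₁.HasLeviCivita) (i₂ : g₂.HasLeviCivita) (x : U) :
    g₁.ricci x = g₂.ricci x := by
  subst h; rfl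

omit [𝓑.metric.HasLeviCivita]
  [(𝓑.metric.restrict PseudoRiemannianMetric.contMDiff_restrict_holds U).HasLeviCivita] in
/-- Equal metrics have the same Killing fields, whatever the instances. [folklore] -/
theorem isKillingField_congr_metric''
    {g₁ g₂ : PseudoRiemannianMetric (𝓡 4) ∞ E4 (TangentSpace (𝓡 4) : U → Type _)} (h : g₁ = g₂)
    (i₁ : g₁.HasLeviCivita) (i₂ : g₂.HasLeviCivita) (X : Π x : U, TangentSpace (𝓡 4) x) :
    g₁.IsKillingField X ↔ g₂.IsKillingField X := by
  subst h; rfl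

/-- **A field Killing on an open set `W ⊇ U`, read on the open sub-carrier `U`, is a (global)
Killing field of `g|U`.**  `g|U = ι^* g` (`restrict_eq_comap`), `K|U = ι^* K`
(`mpullback_subtypeVal`) and Killing fields on an open set pull back (`IsKillingFieldOn.comap_mpullback`).
O'Neill 1983, Ch. 9, Prop. 9.25 with Ch. 3, p. 57. -/
theorem isKillingField_restrict_of_isKillingFieldOn {K : Π x : 𝓑.carrier, TangentSpace (𝓡 4) x}
    {W : Set 𝓑.carrier} (hW : IsOpen W) (hUW : (U : Set 𝓑.carrier) ⊆ W)
    (hK : 𝓑.metric.toPseudoRiemannianMetric.IsKillingFieldOn K W) :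
    (𝓑.metric.restrict PseudoRiemannianMetric.contMDiff_restrict_holds
        U).toPseudoRiemannianMetric.IsKillingField (fun y : U ↦ (K y.1 : TangentSpace (𝓡 4) y)) := by
  set gc := 𝓑.metric.toPseudoRiemannianMetric.comap
    PseudoRiemannianMetric.contMDiff_pullbackBilin_holds
    (Subtype.val : U → 𝓑.carrier) contMDiff_subtype_val
    (injective_mfderiv_subtypeVal U) rfl with hgc_def
  haveI hgcLC : gc.HasLeviCivita := gc.hasLeviCivita
  have hgc : (𝓑.metric.restrict PseudoRiemannianMetric.contMDiff_restrict_holds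
      U).toPseudoRiemannianMetric = gc :=
    PseudoRiemannianMetric.restrict_eq_comap 𝓑.metric.toPseudoRiemannianMetric U
  have key : gc.IsKillingFieldOn (mpullback (𝓡 4) (𝓡 4) (Subtype.val : U → 𝓑.carrier) K)
      ((Subtype.val : U → 𝓑.carrier) ⁻¹' W) :=
    PseudoRiemannianMetric.IsKillingFieldOn.comap_mpullback 𝓑.metric.toPseudoRiemannianMetric
      PseudoRiemannianMetric.contMDiff_pullbackBilin_holds contMDiff_subtype_val
      (injective_mfderiv_subtypeVal U) rfl hW hK
  have huniv : ((Subtype.val : U → 𝓑.carrier) ⁻¹' W) = univ :=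
    eq_univ_of_forall fun y ↦ hUW y.2
  rw [mpullback_subtypeVal, huniv, PseudoRiemannianMetric.isKillingFieldOn_univ] at key
  exact (isKillingField_congr_metric'' 𝓑 U hgc inferInstance hgcLC _).2 key

/-- **The connection restricts, local form: `∇^{g|U}_v (K|U)(y) = ∇^g_v K (↑y)`** for a section
`K` differentiable at `↑y` (naturality of the Levi-Civita connection under the inclusion,
`leviCivita_comap_mpullback_apply`, `dι = id`). O'Neill 1983, Ch. 3, Prop. 3.59 and p. 57. -/
theorem leviCivita_restrict_apply_of_mdifferentiableAt {K : Π x : 𝓑.carrier, TangentSpace (𝓡 4) x}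
    (y : U) (hK : MDifferentiableAt (𝓡 4) (𝓡 4).tangent
      (fun x ↦ (TotalSpace.mk' E4 x (K x) : TangentBundle (𝓡 4) 𝓑.carrier)) y.1)
    (v : TangentSpace (𝓡 4) y) :
    (𝓑.metric.restrict PseudoRiemannianMetric.contMDiff_restrict_holds
        U).toPseudoRiemannianMetric.leviCivita (fun y : U ↦ (K y.1 : TangentSpace (𝓡 4) y)) y v =
      𝓑.metric.toPseudoRiemannianMetric.leviCivita K y.1 v := by
  set gc := 𝓑.metric.toPseudoRiemannianMetric.comap
    PseudoRiemannianMetric.contMDiff_pullbackBilin_holds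
    (Subtype.val : U → 𝓑.carrier) contMDiff_subtype_val
    (injective_mfderiv_subtypeVal U) rfl with hgc_def
  haveI hgcLC : gc.HasLeviCivita := gc.hasLeviCivita
  have hgc : (𝓑.metric.restrict PseudoRiemannianMetric.contMDiff_restrict_holds
      U).toPseudoRiemannianMetric = gc :=
    PseudoRiemannianMetric.restrict_eq_comap 𝓑.metric.toPseudoRiemannianMetric U
  rw [leviCivita_congr_metric'' 𝓑 U hgc inferInstance hgcLC, ← mpullback_subtypeVal U K,
    𝓑.metric.toPseudoRiemannianMetric.leviCivita_comap_mpullback_apply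
      PseudoRiemannianMetric.contMDiff_pullbackBilin_holds contMDiff_subtype_val
      (injective_mfderiv_subtypeVal U) rfl hK v,
    inverse_mfderiv_subtypeVal_apply, mfderiv_subtypeVal_apply]

/-- **The Ricci tensor restricts: `Ric^{g|U}_y (v, w) = Ric^g_{↑y} (v, w)`** (naturality of the
Ricci tensor under the inclusion, `ricci_comap_apply`, `dι = id`). O'Neill 1983, Ch. 3, Prop. 3.59. -/
theorem ricci_restrict_apply (y : U) (v w : TangentSpace (𝓡 4) y) :
    (𝓑.metric.restrict PseudoRiemannianMetric.contMDiff_restrict_holds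
        U).toPseudoRiemannianMetric.ricci y v w = 𝓑.metric.toPseudoRiemannianMetric.ricci y.1 v w := by
  set gc := 𝓑.metric.toPseudoRiemannianMetric.comap
    PseudoRiemannianMetric.contMDiff_pullbackBilin_holds
    (Subtype.val : U → 𝓑.carrier) contMDiff_subtype_val
    (injective_mfderiv_subtypeVal U) rfl with hgc_def
  haveI hgcLC : gc.HasLeviCivita := gc.hasLeviCivita
  have hgc : (𝓑.metric.restrict PseudoRiemannianMetric.contMDiff_restrict_holds
      U).toPseudoRiemannianMetric = gc :=
    PseudoRiemannianMetric.restrict_eq_comap 𝓑.metric.toPseudoRiemannianMetric U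
  rw [ricci_congr_metric'' 𝓑 U hgc inferInstance hgcLC,
    𝓑.metric.toPseudoRiemannianMetric.ricci_comap_apply
      PseudoRiemannianMetric.contMDiff_pullbackBilin_holds contMDiff_subtype_val
      (injective_mfderiv_subtypeVal U) rfl y v w,
    mfderiv_subtypeVal_apply, mfderiv_subtypeVal_apply]

/-- **Vacuum restricts**: the metric of an open sub-carrier of a Ricci-flat presentation is
Ricci-flat. O'Neill 1983, Ch. 3, Prop. 3.59. -/
theorem isRicciFlat_restrict_of_isRicciFlat
    (hvac : 𝓑.metric.toPseudoRiemannianMetric.IsRicciFlat) :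
    (𝓑.metric.restrict PseudoRiemannianMetric.contMDiff_restrict_holds
        U).toPseudoRiemannianMetric.IsRicciFlat := by
  intro y
  ext v w
  rw [ricci_restrict_apply 𝓑 U y v w, hvac y.1]
  rfl

end Restrict


/-- **Registered sub-goal form of step D** (closed statement, crux stmt-FinalStateConjecture-17840):
a field Killing on an open set, read on an open sub-carrier inside it, is a Killing field of the
restricted metric. -/
theorem stub_isKillingField_restrict_of_isKillingFieldOn : ∀ (𝓑 : StationaryAFBlackHole.{0}) [𝓑.metric.HasLeviCivita] (U : TopologicalSpace.Opens 𝓑.carrier) [(𝓑.metric.restrict PseudoRiemannianMetric.contMDiff_restrict_holds U).HasLeviCivita] (K : Π x : 𝓑.carrier, TangentSpace (𝓡 4) x) (W : Set 𝓑.carrier), IsOpen W → (U : Set 𝓑.carrier) ⊆ W → 𝓑.metric.toPseudoRiemannianMetric.IsKillingFieldOn K W → (𝓑.metric.restrict PseudoRiemannianMetric.contMDiff_restrict_holds U).toPseudoRiemannianMetric.IsKillingField (fun y : U ↦ (K y.1 : TangentSpace (𝓡 4) y)) :=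
  fun 𝓑 _ U _ _ _ hW hUW hK ↦ isKillingField_restrict_of_isKillingFieldOn 𝓑 U hW hUW hK

end Summit.FinalStateConjecture.FinalStateConjecture.Theorems.HawkingExtensionIsKerr.SketchIdeator2

end
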